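import Literature.MathematicalPhysics.QuantumFieldTheory.Balaban1983to89.B6Partition118KLevelFineL0
import Literature.MathematicalPhysics.QuantumFieldTheory.Balaban1983to89.B6MultiLevelTorusOperatorL0
import Literature.MathematicalPhysics.QuantumFieldTheory.Balaban1983to89.B6Partition118KLevelTorus
/-!
# `Balaban1983to89.B6Partition118KLevelTorusL0` — LEVEL-0 TWIN (programme G-F3′-L0, director-ym LINE №27 / UV3-NODE §24.5; plan `lit-balaban-r03/G-F3L0-PLAN.md`) of `B6Partition118KLevelTorus`:
the same declarations, SAME NAMES AND STATEMENTS, for nested families WITH print's region `Λ₀ = T ∖ Ω₁` ADMITTED (structures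
`B6MultiLevelBoxOperatorL0.Domains` / `B6MultiLevelTorusOperatorL0.TDomains`: levels `0, …, k`, the level-`0` block a single site, `Q′₀ = id`,
finite weight `a₀` — print p.225 (2.14) «Σ_{j=0}^k … (Q′₀λ)(x) = λ(x), x ∈ Λ₀», p.229 «taking a sequence (2.1) … smallest possible domains B^j(Λ_j),
and considering the operator Δ_a defined by (2.19), (2.20) for this sequence»).  Every `D`-free object is the lineage's, consumed BY NAME; no existing
module is touched; no fact is minted.  Unit `lit-balaban-r03` (B6 fold owner, r03 gen 36); referee ref-4.  THE TWIN'S DOCUMENTATION FOLLOWS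
VERBATIM (its «levels 1 … k» / «Ω₁ = X» sentences describe the twin; here `j` runs from `0` and `Ω₁` may be a proper subset).

# `Balaban1983to89.B6Partition118KLevelTorus` — T. Bałaban, *Propagators and renormalization transformations for lattice gauge theories. II*,
# Commun. Math. Phys. **96** (1984) 223–250 [Balaban1984PropagatorsII], (2.36) p. 229 with [Balaban1984PropagatorsI] (1.118) p. 36: THE SMOOTH PARTITION
# OF UNITY `{h_□}_{□∈𝒟}`, `Σ_□ h_□² = 1`, OF THE GENUINE MULTI-LEVEL COVER **ON THE TORUS `T_η`** — the PERIODIC (1.118) bumps of the active big blocks of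
# a nested family `D : TDomains`, the normalised family `h^T_□ = θ^T_□/(Σθ²)^{1/2}` and `Σ_□ h^T_□(z)² = 1` at every torus site (file 1 of route (A) of
# B6-CLOSURE §5 item 11 / GAPS G-B6-p38-04; file 2 `…B6Partition118KLevelTorusChart` is the chart dictionary, file 3 `…TorusBinders` the (2.134) binders)

statement-level skeleton of published theorems with citation tags; proofs where landed; nothing here is a claim about the Yang–Mills mass gap

PDF held: `paper:balaban1984-cmp96-propagators-rt-ii` (journal page = PDF page + 222): p. 224 [PDF 2] ((2.1): the domains are subsets of the TORUS
`T_η`), p. 229 [PDF 7] ((2.36): *"Taking these covers for all j from 0 to k we get a family 𝒟 of cubes □ … such that T_η = ⋃_{□∈𝒟} □. We construct also the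
corresponding family of functions h described in (1.118), and rescale them to proper scales. They satisfy Σ_{□∈𝒟} h_□² = 1."*), p. 239 [PDF 17] ((2.89)),
p. 247 [PDF 25] ((2.134)); [Balaban1984PropagatorsI] (1.118) p. 36 (`paper:balaban1984-cmp95-propagators-rt-i`): *"h ∈ C₀^∞(]−⅔, ⅔[), h(t) = 1 for
t ∈ [−⅓, ⅓], … Σ_n h²(t − n) = 1"* — read from the tree transcriptions in `…B6Cover236MultiLevelBlocks`, `…B6Eq238MultiLevelTorus`, `…B4PartitionUnity22`.

CITATION HEADER (lean-in-tree rule) — WHAT IS REPRODUCED.  Phase-2 file of the `lit-balaban` typed skeleton (HOME `run/shared/lean/pub/lit-balaban/`), seat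
**p38 gen 26**; SKELETON rows **B6.Eq2.36** × **B5.Eq1.118** × **B6.Eq2.91/2.134** (cells only; decls of record untouched; owner r03, referee ref-4).  Gen 25's
five files `…B6Partition118KLevelFine{,Sizes,Second,Lip,KIdx}` built `{h_□}` and its (2.134)-binders ON THE BOX (p21's `Domains`, distance (2.46) of the
fundamental box); the Prop. 2.6 assembly of record (r03's ROUTE V, `…B6GlobalChartV1`) lives ON THE TORUS, where a box cube cut by a face of the fundamental
domain is not a cube (GAPS G-B6-p38-04).  Print has no such issue: the cover (2.36) is a cover of `T_η`.  THIS FILE builds the periodic family directly: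
* §1 `circR N t = |t − N·round(t/N)|` = `dist(t, Nℤ)` for real `t` (the torus distance of one coordinate; `hprof` is even) and THE ONE-VARIABLE LEMMA
  `hprof_circR_eq`: `hprof(circR N t/(8S/5)) = hprof(t/(8S/5))` whenever `2S ≤ N`, `|t| ≤ N − S` (both sides vanish unless `|t| < N/2`, where they agree) —
  the only analytic input of the chart dictionary of file 2;
* §2 THE PERIODIC FAMILY: torus cubes = p21's active big blocks `cubes D.toDomains` (a torus site IS a site of the fundamental box; activity is chart-free),
  `thetaT c z = Π_μ hprof(circR N₀_μ(z_μ − (β_μ + ½)S_j)/(8S_j/5))`, `0 ≤ θ ≤ 1`, `θ_{own} = 1`, `nsqT = Σθ² ≥ 1`, **`hT = θ/√(Σθ²)`, `Σ_□ hT □ z² = 1`**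
  (`sum_hT_sq`, `sum_hT_mul_self` — the `hpart` shape of `…B6Eq291Generator.eq291`), `0 ≤ hT ≤ 1` (`hh1`).
No `def : Prop`, no new fact; defs with bodies (`circR`, `thetaT`, `nsqT`, `hT`); standard axioms.
HONEST SCOPE / DIVERGENCES. (1) As gen 25: the normalisation `θ/(Σθ²)^{1/2}` across adjacent levels is ours (print silent; cell divergence D-b06.38/42); the
cubes are p21's big-block-centred cubes of `…B6Cover236MultiLevelBlocks` (side `2S`, `S = M·L^j`), now periodic. (2) Integer torus `Π_μ[0, N₀_μ)`,
`N₀ = M·L^k·P`; nothing on d = 4 or the continuum; NOT summit progress.  Unit `lit-balaban-p38` (gen 26), 2026-08-23.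
-/

namespace Literature.MathematicalPhysics.QuantumFieldTheory.Balaban1983to89.B6Partition118KLevelTorusL0

open Finset
open Literature.MathematicalPhysics.QuantumFieldTheory.Balaban1983to89.B4Reflection242 (boxDom mem_boxDom blk)
open Literature.MathematicalPhysics.QuantumFieldTheory.Balaban1983to89.B6MultiLevelBoxOperator (N0 bigSide bigSide_eq one_le_bigSide)
open Literature.MathematicalPhysics.QuantumFieldTheory.Balaban1983to89.B6MultiLevelBoxOperatorL0 (Domains)
open Literature.MathematicalPhysics.QuantumFieldTheory.Balaban1983to89.B6MultiLevelTorusOperatorL0 (TDomains)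
open Literature.MathematicalPhysics.QuantumFieldTheory.Balaban1983to89.B6Geom246MultiLevelBox (toR)
open Literature.MathematicalPhysics.QuantumFieldTheory.Balaban1983to89.B6Geom246MultiLevelBoxL0 (bset blkOf)
open Literature.MathematicalPhysics.QuantumFieldTheory.Balaban1983to89.B6Cover236MultiLevelBlocksL0 (cubes side side_pos ctr dist_toR_ctr_le own)
open Literature.MathematicalPhysics.QuantumFieldTheory.Balaban1983to89.B4PartitionUnity22
  (hprof hprof_neg hprof_nonneg hprof_le_one hprof_eq_one hprof_eq_zero)
open Literature.MathematicalPhysics.QuantumFieldTheory.Balaban1983to89.B6Partition118KLevelFineL0 (blk_bigSide_eq_own)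
open Literature.MathematicalPhysics.QuantumFieldTheory.Balaban1983to89.B6Partition118KLevelTorus (circR circR_nonneg circR_add_mul circR_le_abs_sub_mul circR_le_abs circR_of_abs_lt circR_ge_of_abs_le hprof_circR_eq thetaT thetaT_nonneg thetaT_le_one)

variable {d : ℕ}

/-! ## §1  The distance to `Nℤ` of a real number and the one-variable lemma -/

section Torus

variable {ℓ Mh k R : ℕ} {P : Fin (d + 1) → ℕ} (D : TDomains d ℓ Mh k P R)

/-- **THE BUMP OF THE OWN BIG BLOCK IS `1`** at every torus site (the site is within `S/2` of the centre of its big block, in each coordinate, before and hence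
after passing to the torus distance). [cite: Balaban1984PropagatorsII, p.229 («Each set Λ_j is a sum of big blocks»); Balaban1984PropagatorsI, (1.118) p.36 («h(t) = 1 for t ∈ [−⅓, ⅓]»)] -/
theorem thetaT_own_eq_one (hMh : 1 ≤ Mh) (hP : ∀ μ, 1 ≤ P μ) (z : ↥(boxDom (N0 ℓ Mh k P))) :
    thetaT ℓ Mh (N0 ℓ Mh k P) (B6Cover236MultiLevelBlocksL0.own D.toDomains (blkOf D.toDomains z)).1 z.1 = 1 := by
  set i := own D.toDomains (blkOf D.toDomains z) with hi
  have hS : 0 < side D.toDomains i := side_pos D.toDomains hMh i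
  have hdist : dist (toR z.1) (ctr D.toDomains i) ≤ side D.toDomains i / 2 :=
    dist_toR_ctr_le D.toDomains hMh (by rw [hi]; exact blk_bigSide_eq_own D.toDomains z)
  unfold thetaT
  refine Finset.prod_eq_one fun μ _ => hprof_eq_one ?_
  have hN1 : 1 ≤ N0 ℓ Mh k P μ := B6MultiLevelTorusOperator.one_le_N0 hMh hP μ
  have hμ := (dist_le_pi_dist (toR z.1) (ctr D.toDomains i) μ).trans hdist
  rw [Real.dist_eq] at hμ
  have eS : (bigSide ℓ Mh i.1.1 : ℝ) = side D.toDomains i := rfl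
  have ec : ((i.1.2 μ : ℝ) + 1 / 2) * (bigSide ℓ Mh i.1.1 : ℝ) = ctr D.toDomains i μ := rfl
  have ez : (z.1 μ : ℝ) = toR z.1 μ := rfl
  rw [ec, eS, ez, abs_div, abs_of_pos (by positivity : (0 : ℝ) < 8 / 5 * side D.toDomains i), div_le_iff₀ (by positivity),
    abs_of_nonneg (circR_nonneg _ _)]
  have h1 := circR_le_abs hN1 (toR z.1 μ - ctr D.toDomains i μ)
  linarith

/-- **`Σ_□ θ^T_□(z)²`** over the torus cubes (p21's active big blocks `cubes D.toDomains`: a torus site IS a site of the fundamental box, so activity needs no chart).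
[cite: Balaban1984PropagatorsII, (2.36) p.229, bookkeeping] -/
noncomputable def nsqT (z : ↥(boxDom (N0 ℓ Mh k P))) : ℝ := ∑ c : ↥(cubes D.toDomains), thetaT ℓ Mh (N0 ℓ Mh k P) c.1 z.1 ^ 2

/-- `Σ_□ θ^T_□(z)² ≥ 1` (the own big block contributes `1`). [cite: Balaban1984PropagatorsII, (2.36) p.229, bookkeeping] -/
theorem one_le_nsqT (hMh : 1 ≤ Mh) (hP : ∀ μ, 1 ≤ P μ) (z : ↥(boxDom (N0 ℓ Mh k P))) : 1 ≤ nsqT D z := by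
  unfold nsqT
  calc (1 : ℝ) = thetaT ℓ Mh (N0 ℓ Mh k P) (own D.toDomains (blkOf D.toDomains z)).1 z.1 ^ 2 := by rw [thetaT_own_eq_one D hMh hP z]; norm_num
    _ ≤ ∑ c : ↥(cubes D.toDomains), thetaT ℓ Mh (N0 ℓ Mh k P) c.1 z.1 ^ 2 :=
        Finset.single_le_sum (f := fun c : ↥(cubes D.toDomains) => thetaT ℓ Mh (N0 ℓ Mh k P) c.1 z.1 ^ 2) (fun _ _ => sq_nonneg _) (Finset.mem_univ _)

/-- `Σθ² > 0`. [cite: Balaban1984PropagatorsII, (2.36) p.229, bookkeeping] -/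
theorem nsqT_pos (hMh : 1 ≤ Mh) (hP : ∀ μ, 1 ≤ P μ) (z : ↥(boxDom (N0 ℓ Mh k P))) : 0 < nsqT D z :=
  lt_of_lt_of_le one_pos (one_le_nsqT D hMh hP z)

/-- `1 ≤ (Σθ²)^{1/2}`. [cite: Balaban1984PropagatorsII, (2.36) p.229, bookkeeping] -/
theorem one_le_sqrt_nsqT (hMh : 1 ≤ Mh) (hP : ∀ μ, 1 ≤ P μ) (z : ↥(boxDom (N0 ℓ Mh k P))) : 1 ≤ Real.sqrt (nsqT D z) := by
  rw [← Real.sqrt_one]; exact Real.sqrt_le_sqrt (one_le_nsqT D hMh hP z)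

/-- **`h^T_□` ON THE TORUS**: `θ^T_□(z)/(Σ_{□′} θ^T_{□′}(z)²)^{1/2}` — the periodic partition (2.36) of `T_η`.
[cite: Balaban1984PropagatorsII, (2.36) p.229; Balaban1984PropagatorsI, (1.118) p.36] -/
noncomputable def hT (c : ↥(cubes D.toDomains)) (z : ↥(boxDom (N0 ℓ Mh k P))) : ℝ :=
  thetaT ℓ Mh (N0 ℓ Mh k P) c.1 z.1 / Real.sqrt (nsqT D z)

/-- `h^T ≥ 0`. [cite: Balaban1984PropagatorsII, (2.36) p.229, bookkeeping] -/
theorem hT_nonneg (c : ↥(cubes D.toDomains)) (z : ↥(boxDom (N0 ℓ Mh k P))) : 0 ≤ hT D c z :=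
  div_nonneg (thetaT_nonneg _ _ _ _ _) (Real.sqrt_nonneg _)

/-- `h^T_□ ≤ θ^T_□`. [cite: Balaban1984PropagatorsII, (2.36) p.229, bookkeeping] -/
theorem hT_le_thetaT (hMh : 1 ≤ Mh) (hP : ∀ μ, 1 ≤ P μ) (c : ↥(cubes D.toDomains)) (z : ↥(boxDom (N0 ℓ Mh k P))) :
    hT D c z ≤ thetaT ℓ Mh (N0 ℓ Mh k P) c.1 z.1 :=
  div_le_self (thetaT_nonneg _ _ _ _ _) (one_le_sqrt_nsqT D hMh hP z)

/-- `h^T ≤ 1`. [cite: Balaban1984PropagatorsII, (2.36) p.229, bookkeeping] -/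
theorem hT_le_one (hMh : 1 ≤ Mh) (hP : ∀ μ, 1 ≤ P μ) (c : ↥(cubes D.toDomains)) (z : ↥(boxDom (N0 ℓ Mh k P))) : hT D c z ≤ 1 :=
  (hT_le_thetaT D hMh hP c z).trans (thetaT_le_one _ _ _ _ _)

/-- `|h^T| ≤ 1` (the binder `hh1` of the (2.134) consumers). [cite: Balaban1984PropagatorsII, (2.36) p.229, (2.134) p.247] -/
theorem abs_hT_le_one (hMh : 1 ≤ Mh) (hP : ∀ μ, 1 ≤ P μ) (c : ↥(cubes D.toDomains)) (z : ↥(boxDom (N0 ℓ Mh k P))) : |hT D c z| ≤ 1 := by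
  rw [abs_of_nonneg (hT_nonneg D c z)]; exact hT_le_one D hMh hP c z

/-- **(2.36) ON THE TORUS: `Σ_{□∈𝒟} h^T_□(z)² = 1` AT EVERY SITE OF `T_η`.** [cite: Balaban1984PropagatorsII, (2.36) p.229 («They satisfy Σ_{□∈𝒟} h_□² = 1»)] -/
theorem sum_hT_sq (hMh : 1 ≤ Mh) (hP : ∀ μ, 1 ≤ P μ) (z : ↥(boxDom (N0 ℓ Mh k P))) : ∑ c, hT D c z ^ 2 = 1 := by
  have h1 := one_le_nsqT D hMh hP z
  unfold hT
  simp_rw [div_pow]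
  rw [← Finset.sum_div, Real.sq_sqrt (by linarith)]
  exact div_self (ne_of_gt (lt_of_lt_of_le one_pos h1))

/-- the same with `h·h` (the `hpart` shape of `…B6Eq291Generator.eq291`). [cite: Balaban1984PropagatorsII, (2.36) p.229, (2.91) p.239] -/
theorem sum_hT_mul_self (hMh : 1 ≤ Mh) (hP : ∀ μ, 1 ≤ P μ) (z : ↥(boxDom (N0 ℓ Mh k P))) : ∑ c, hT D c z * hT D c z = 1 := by
  simpa only [sq] using sum_hT_sq D hMh hP z

/-- `h^T_□(z) ≠ 0 ⟹ θ^T_□(z) ≠ 0`. [cite: Balaban1984PropagatorsII, (2.36) p.229, bookkeeping] -/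
theorem thetaT_ne_zero_of_hT_ne_zero {c : ↥(cubes D.toDomains)} {z : ↥(boxDom (N0 ℓ Mh k P))} (h : hT D c z ≠ 0) :
    thetaT ℓ Mh (N0 ℓ Mh k P) c.1 z.1 ≠ 0 := fun h0 => h (by unfold hT; rw [h0, zero_div])

end Torus

end Literature.MathematicalPhysics.QuantumFieldTheory.Balaban1983to89.B6Partition118KLevelTorusL0
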